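import Summits.Ventures.PercRepro.C041FourExitZone

/-!
# ROW C-041 — THE FIVE-EXIT ATTACHMENT and its zone sets at the anchor (p6, gen 31; groundwork for r = 5 — step (1)
of the recipe; the same shape as `C041FourExitZone`)

`glue5` hangs `Z''''` at `u''''` on the four-exit attachment; every reach is inherited (`mem_K_glue4_iff`,
`mem_P_glue4_iff`), and the zone sets at the anchor read off the statuses of the five exits (`anchor₅_mem_D_iff` /
`_D2_iff`, `adm₅_iff`, `blueK₅_iff`).
-/

namespace PercRepro

namespace ZoneZ

namespace TwoExit

open ZoneData Pendant AnchorGlue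

variable {V₁ E₁ U₁ U₂ V E T₁ T₂ V' E' T₁' T₂' V'' E'' T₁'' T₂'' V''' E''' T₁''' T₂''' V'''' E'''' T₁'''' T₂'''' : Type}
variable (Z₁ : ZoneData V₁ E₁ U₁ U₂) (u u' u'' u''' u'''' : V₁) (Z : ZoneData V E T₁ T₂) (a : V)
  (Z' : ZoneData V' E' T₁' T₂') (a' : V') (Z'' : ZoneData V'' E'' T₁'' T₂'') (a'' : V'')
  (Z''' : ZoneData V''' E''' T₁''' T₂''') (a''' : V''') (Z'''' : ZoneData V'''' E'''' T₁'''' T₂'''') (a'''' : V'''')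

/-- THE FIVE-EXIT ATTACHMENT: the four-exit attachment, then `Z''''` at `u''''`. -/
noncomputable abbrev glue5 :
    ZoneData (((((V₁ ⊕ V') ⊕ V) ⊕ V'') ⊕ V''') ⊕ V'''') (((((E₁ ⊕ E') ⊕ E) ⊕ E'') ⊕ E''') ⊕ E'''')
      ((((T₁' ⊕ T₁) ⊕ T₁'') ⊕ T₁''') ⊕ T₁'''') ((((T₂' ⊕ T₂) ⊕ T₂'') ⊕ T₂''') ⊕ T₂'''') :=
  glue (glue4 Z₁ u u' u'' u''' Z a Z' a' Z'' a'' Z''' a''') (Sum.inl (Sum.inl (Sum.inl (Sum.inl u'''')))) Z'''' a''''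

variable (σ : State (((((E₁ ⊕ E') ⊕ E) ⊕ E'') ⊕ E''') ⊕ E'''') ((((T₁' ⊕ T₁) ⊕ T₁'') ⊕ T₁''') ⊕ T₁'''')
  ((((T₂' ⊕ T₂) ⊕ T₂'') ⊕ T₂''') ⊕ T₂''''))

/-- The colouring of `Z₁` in a state of the five-exit attachment. -/
def col₁₅ : E₁ → Bool := col₁₄ (restrL σ)

/-- The state of `Z'`. -/
def st'₅ : State E' T₁' T₂' := st'₄ (restrL σ)

/-- The state of `Z`. -/
def st₅ : State E T₁ T₂ := st₄ (restrL σ)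

/-- The state of `Z''`. -/
def st''₅ : State E'' T₁'' T₂'' := st''₄ (restrL σ)

/-- The state of `Z'''`. -/
def st'''₅ : State E''' T₁''' T₂''' := st'''₄ (restrL σ)

/-- The state of `Z''''`. -/
def st''''₅ : State E'''' T₁'''' T₂'''' := restrR σ

variable (a₁ : V₁)

/-- The red reach of the anchor at a `Z₁`-vertex of the four-exit attachment: the reach inside `Z₁`. -/
theorem mem_K_glue4_iff (τ : State ((((E₁ ⊕ E') ⊕ E) ⊕ E'') ⊕ E''') (((T₁' ⊕ T₁) ⊕ T₁'') ⊕ T₁''') (((T₂' ⊕ T₂) ⊕ T₂'') ⊕ T₂''')) (v : V₁) :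
    Sum.inl (Sum.inl (Sum.inl (Sum.inl v))) ∈ (glue4 Z₁ u u' u'' u''' Z a Z' a' Z'' a'' Z''' a''').K {Sum.inl (Sum.inl (Sum.inl (Sum.inl a₁)))} τ ↔ Z₁.Rd a₁ v (col₁₄ τ) := by
  rw [inl_mem_K_iff_of_anchor, mem_K_glue3_iff]
  rfl

/-- The blue reach of the four-exit attachment from `inl⁴ u''''`, at a `Z₁`-vertex: blue connectivity to `u''''`
inside `Z₁`. -/
theorem mem_P_glue4_iff (τ : State ((((E₁ ⊕ E') ⊕ E) ⊕ E'') ⊕ E''') (((T₁' ⊕ T₁) ⊕ T₁'') ⊕ T₁''') (((T₂' ⊕ T₂) ⊕ T₂'') ⊕ T₂''')) (v : V₁) :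
    Sum.inl (Sum.inl (Sum.inl (Sum.inl v))) ∈ (glue4 Z₁ u u' u'' u''' Z a Z' a' Z'' a'' Z''' a''').P {Sum.inl (Sum.inl (Sum.inl (Sum.inl u'''')))} τ ↔
      Z₁.Mg v u'''' (col₁₄ τ) := by
  unfold P BlueAdj
  rw [adj_eq_cAdj, AnchorGlue.inl_mem_reach_iff (glue3 Z₁ u u' u'' Z a Z' a' Z'' a'') (Sum.inl (Sum.inl (Sum.inl u''')))
    Z''' a''' false τ _ (by simp), junction_singleton_iff_of_anchor]
  have e1 : leftSet ({Sum.inl (Sum.inl (Sum.inl (Sum.inl u'''')))} : Set ((((V₁ ⊕ V') ⊕ V) ⊕ V'') ⊕ V''')) =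
      {Sum.inl (Sum.inl (Sum.inl u''''))} := by
    ext x
    simp [leftSet]
  rw [e1]
  have h1 := mem_P_glue3_iff Z₁ u u' u'' u'''' Z a Z' a' Z'' a'' (restrL τ) v
  have h2 := mem_P_glue3_iff Z₁ u u' u'' u'''' Z a Z' a' Z'' a'' (restrL τ) u'''
  have h3 := mem_P_glue3_iff Z₁ u u' u'' u''' Z a Z' a' Z'' a'' (restrL τ) v
  change (Sum.inl (Sum.inl (Sum.inl v)) ∈ (glue3 Z₁ u u' u'' Z a Z' a' Z'' a'').P {Sum.inl (Sum.inl (Sum.inl u''''))}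
      (restrL τ) ∨
    (Sum.inl (Sum.inl (Sum.inl u''')) ∈ (glue3 Z₁ u u' u'' Z a Z' a' Z'' a'').P {Sum.inl (Sum.inl (Sum.inl u''''))}
      (restrL τ) ∧
      Sum.inl (Sum.inl (Sum.inl v)) ∈ (glue3 Z₁ u u' u'' Z a Z' a' Z'' a'').P {Sum.inl (Sum.inl (Sum.inl u'''))}
        (restrL τ))) ↔ _
  rw [h1, h2, h3]
  constructor
  · rintro (h | ⟨hu, hv⟩)
    · exact h
    · exact Mg_trans Z₁ _ _ _ _ hv hu
  · intro h
    exact Or.inl h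

/-- The junction `u''''` is deleted in the five-exit attachment iff `a''''` is deleted in `Z''''`, or some earlier
exit's zone has its anchor deleted with `u''''` blue-connected to that exit. -/
theorem junction₅_mem_D_iff :
    Sum.inl (Sum.inl (Sum.inl (Sum.inl (Sum.inl u'''')))) ∈ (glue5 Z₁ u u' u'' u''' u'''' Z a Z' a' Z'' a'' Z''' a''' Z'''' a'''').D σ ↔
      (a' ∈ Z'.D (st'₅ σ) ∧ Z₁.Mg u'''' u' (col₁₅ σ)) ∨ (a ∈ Z.D (st₅ σ) ∧ Z₁.Mg u'''' u (col₁₅ σ)) ∨ (a'' ∈ Z''.D (st''₅ σ) ∧ Z₁.Mg u'''' u'' (col₁₅ σ)) ∨ (a''' ∈ Z'''.D (st'''₅ σ) ∧ Z₁.Mg u'''' u''' (col₁₅ σ)) ∨ a'''' ∈ Z''''.D (st''''₅ σ) := by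
  rw [AnchorGlue.inl_a_mem_D_iff, anchor₄_mem_D_iff, or_assoc, or_assoc, or_assoc]
  rfl

/-- The junction `u''''` is deleted on side `2`. -/
theorem junction₅_mem_D2_iff :
    Sum.inl (Sum.inl (Sum.inl (Sum.inl (Sum.inl u'''')))) ∈ (glue5 Z₁ u u' u'' u''' u'''' Z a Z' a' Z'' a'' Z''' a''' Z'''' a'''').D2 σ ↔
      (a' ∈ Z'.D2 (st'₅ σ) ∧ Z₁.Mg u'''' u' (col₁₅ σ)) ∨ (a ∈ Z.D2 (st₅ σ) ∧ Z₁.Mg u'''' u (col₁₅ σ)) ∨ (a'' ∈ Z''.D2 (st''₅ σ) ∧ Z₁.Mg u'''' u'' (col₁₅ σ)) ∨ (a''' ∈ Z'''.D2 (st'''₅ σ) ∧ Z₁.Mg u'''' u''' (col₁₅ σ)) ∨ a'''' ∈ Z''''.D2 (st''''₅ σ) := by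
  rw [AnchorGlue.inl_a_mem_D2_iff, anchor₄_mem_D2_iff, or_assoc, or_assoc, or_assoc]
  rfl

/-- **The anchor is deleted** iff some exit is merged with its zone's anchor deleted. -/
theorem anchor₅_mem_D_iff :
    Sum.inl (Sum.inl (Sum.inl (Sum.inl (Sum.inl a₁)))) ∈ (glue5 Z₁ u u' u'' u''' u'''' Z a Z' a' Z'' a'' Z''' a''' Z'''' a'''').D σ ↔
      (a' ∈ Z'.D (st'₅ σ) ∧ Z₁.Mg a₁ u' (col₁₅ σ)) ∨
        (a ∈ Z.D (st₅ σ) ∧ Z₁.Mg a₁ u (col₁₅ σ)) ∨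
        (a'' ∈ Z''.D (st''₅ σ) ∧ Z₁.Mg a₁ u'' (col₁₅ σ)) ∨
        (a''' ∈ Z'''.D (st'''₅ σ) ∧ Z₁.Mg a₁ u''' (col₁₅ σ)) ∨
        (a'''' ∈ Z''''.D (st''''₅ σ) ∧ Z₁.Mg a₁ u'''' (col₁₅ σ)) := by
  rw [AnchorGlue.inl_mem_D_iff, junction₅_mem_D_iff, anchor₄_mem_D_iff, mem_P_glue4_iff]
  unfold st'₅ st₅ st''₅ st'''₅ col₁₅
  constructor
  · rintro (h | ⟨(⟨hD', hc⟩ | ⟨hD, hc⟩ | ⟨hD'', hc⟩ | ⟨hD''', hc⟩ | hD''''), hm⟩)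
    · rcases h with h | h | h | h
      · exact Or.inl h
      · exact Or.inr (Or.inl h)
      · exact Or.inr (Or.inr (Or.inl h))
      · exact Or.inr (Or.inr (Or.inr (Or.inl h)))
    · exact Or.inl ⟨hD', Mg_trans Z₁ _ _ _ _ hm hc⟩
    · exact Or.inr (Or.inl ⟨hD, Mg_trans Z₁ _ _ _ _ hm hc⟩)
    · exact Or.inr (Or.inr (Or.inl ⟨hD'', Mg_trans Z₁ _ _ _ _ hm hc⟩))
    · exact Or.inr (Or.inr (Or.inr (Or.inl ⟨hD''', Mg_trans Z₁ _ _ _ _ hm hc⟩)))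
    · exact Or.inr (Or.inr (Or.inr (Or.inr ⟨hD'''', hm⟩)))
  · rintro (h | h | h | h | ⟨hD'''', hm⟩)
    · exact Or.inl (Or.inl h)
    · exact Or.inl (Or.inr (Or.inl h))
    · exact Or.inl (Or.inr (Or.inr (Or.inl h)))
    · exact Or.inl (Or.inr (Or.inr (Or.inr h)))
    · exact Or.inr ⟨Or.inr (Or.inr (Or.inr (Or.inr hD''''))), hm⟩

/-- **The anchor is deleted on side `2`** iff some exit is merged with its zone's anchor deleted on side `2`. -/
theorem anchor₅_mem_D2_iff :
    Sum.inl (Sum.inl (Sum.inl (Sum.inl (Sum.inl a₁)))) ∈ (glue5 Z₁ u u' u'' u''' u'''' Z a Z' a' Z'' a'' Z''' a''' Z'''' a'''').D2 σ ↔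
      (a' ∈ Z'.D2 (st'₅ σ) ∧ Z₁.Mg a₁ u' (col₁₅ σ)) ∨
        (a ∈ Z.D2 (st₅ σ) ∧ Z₁.Mg a₁ u (col₁₅ σ)) ∨
        (a'' ∈ Z''.D2 (st''₅ σ) ∧ Z₁.Mg a₁ u'' (col₁₅ σ)) ∨
        (a''' ∈ Z'''.D2 (st'''₅ σ) ∧ Z₁.Mg a₁ u''' (col₁₅ σ)) ∨
        (a'''' ∈ Z''''.D2 (st''''₅ σ) ∧ Z₁.Mg a₁ u'''' (col₁₅ σ)) := by
  rw [AnchorGlue.inl_mem_D2_iff, junction₅_mem_D2_iff, anchor₄_mem_D2_iff, mem_P_glue4_iff]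
  unfold st'₅ st₅ st''₅ st'''₅ col₁₅
  constructor
  · rintro (h | ⟨(⟨hD', hc⟩ | ⟨hD, hc⟩ | ⟨hD'', hc⟩ | ⟨hD''', hc⟩ | hD''''), hm⟩)
    · rcases h with h | h | h | h
      · exact Or.inl h
      · exact Or.inr (Or.inl h)
      · exact Or.inr (Or.inr (Or.inl h))
      · exact Or.inr (Or.inr (Or.inr (Or.inl h)))
    · exact Or.inl ⟨hD', Mg_trans Z₁ _ _ _ _ hm hc⟩
    · exact Or.inr (Or.inl ⟨hD, Mg_trans Z₁ _ _ _ _ hm hc⟩)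
    · exact Or.inr (Or.inr (Or.inl ⟨hD'', Mg_trans Z₁ _ _ _ _ hm hc⟩))
    · exact Or.inr (Or.inr (Or.inr (Or.inl ⟨hD''', Mg_trans Z₁ _ _ _ _ hm hc⟩)))
    · exact Or.inr (Or.inr (Or.inr (Or.inr ⟨hD'''', hm⟩)))
  · rintro (h | h | h | h | ⟨hD'''', hm⟩)
    · exact Or.inl (Or.inl h)
    · exact Or.inl (Or.inr (Or.inl h))
    · exact Or.inl (Or.inr (Or.inr (Or.inl h)))
    · exact Or.inl (Or.inr (Or.inr (Or.inr h)))
    · exact Or.inr ⟨Or.inr (Or.inr (Or.inr (Or.inr hD''''))), hm⟩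

/-- **Admissibility of the five-exit attachment**: the five zones admissible and none of the four junctions
deleted on both sides. -/
theorem adm₅_iff :
    (glue5 Z₁ u u' u'' u''' u'''' Z a Z' a' Z'' a'' Z''' a''' Z'''' a'''').adm σ ↔
      Z'.adm (st'₅ σ) ∧ Z.adm (st₅ σ) ∧ Z''.adm (st''₅ σ) ∧ Z'''.adm (st'''₅ σ) ∧ Z''''.adm (st''''₅ σ) ∧
        ¬ (((a' ∈ Z'.D (st'₅ σ) ∧ Z₁.Mg u u' (col₁₅ σ)) ∨ a ∈ Z.D (st₅ σ)) ∧
          ((a' ∈ Z'.D2 (st'₅ σ) ∧ Z₁.Mg u u' (col₁₅ σ)) ∨ a ∈ Z.D2 (st₅ σ))) ∧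
        ¬ (((a' ∈ Z'.D (st'₅ σ) ∧ Z₁.Mg u'' u' (col₁₅ σ)) ∨ (a ∈ Z.D (st₅ σ) ∧ Z₁.Mg u'' u (col₁₅ σ)) ∨
            a'' ∈ Z''.D (st''₅ σ)) ∧
          ((a' ∈ Z'.D2 (st'₅ σ) ∧ Z₁.Mg u'' u' (col₁₅ σ)) ∨ (a ∈ Z.D2 (st₅ σ) ∧ Z₁.Mg u'' u (col₁₅ σ)) ∨
            a'' ∈ Z''.D2 (st''₅ σ))) ∧
        ¬ (((a' ∈ Z'.D (st'₅ σ) ∧ Z₁.Mg u''' u' (col₁₅ σ)) ∨ (a ∈ Z.D (st₅ σ) ∧ Z₁.Mg u''' u (col₁₅ σ)) ∨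
            (a'' ∈ Z''.D (st''₅ σ) ∧ Z₁.Mg u''' u'' (col₁₅ σ)) ∨ a''' ∈ Z'''.D (st'''₅ σ)) ∧
          ((a' ∈ Z'.D2 (st'₅ σ) ∧ Z₁.Mg u''' u' (col₁₅ σ)) ∨ (a ∈ Z.D2 (st₅ σ) ∧ Z₁.Mg u''' u (col₁₅ σ)) ∨
            (a'' ∈ Z''.D2 (st''₅ σ) ∧ Z₁.Mg u''' u'' (col₁₅ σ)) ∨ a''' ∈ Z'''.D2 (st'''₅ σ))) ∧
        ¬ (((a' ∈ Z'.D (st'₅ σ) ∧ Z₁.Mg u'''' u' (col₁₅ σ)) ∨ (a ∈ Z.D (st₅ σ) ∧ Z₁.Mg u'''' u (col₁₅ σ)) ∨ (a'' ∈ Z''.D (st''₅ σ) ∧ Z₁.Mg u'''' u'' (col₁₅ σ)) ∨ (a''' ∈ Z'''.D (st'''₅ σ) ∧ Z₁.Mg u'''' u''' (col₁₅ σ)) ∨ a'''' ∈ Z''''.D (st''''₅ σ)) ∧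
          ((a' ∈ Z'.D2 (st'₅ σ) ∧ Z₁.Mg u'''' u' (col₁₅ σ)) ∨ (a ∈ Z.D2 (st₅ σ) ∧ Z₁.Mg u'''' u (col₁₅ σ)) ∨ (a'' ∈ Z''.D2 (st''₅ σ) ∧ Z₁.Mg u'''' u'' (col₁₅ σ)) ∨ (a''' ∈ Z'''.D2 (st'''₅ σ) ∧ Z₁.Mg u'''' u''' (col₁₅ σ)) ∨ a'''' ∈ Z''''.D2 (st''''₅ σ))) := by
  rw [AnchorGlue.adm_iff, adm₄_iff, junction₅_mem_D_iff, junction₅_mem_D2_iff]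
  unfold st'₅ st₅ st''₅ st'''₅ st''''₅ col₁₅
  tauto

/-- **Blue at `K` at the anchor**: each reached exit's zone is blue at its own `K`. -/
theorem blueK₅_iff :
    (glue5 Z₁ u u' u'' u''' u'''' Z a Z' a' Z'' a'' Z''' a''' Z'''' a'''').blueK {Sum.inl (Sum.inl (Sum.inl (Sum.inl (Sum.inl a₁))))} σ ↔
      (Z₁.Rd a₁ u' (col₁₅ σ) → Z'.blueK {a'} (st'₅ σ)) ∧ (Z₁.Rd a₁ u (col₁₅ σ) → Z.blueK {a} (st₅ σ)) ∧
        (Z₁.Rd a₁ u'' (col₁₅ σ) → Z''.blueK {a''} (st''₅ σ)) ∧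
          (Z₁.Rd a₁ u''' (col₁₅ σ) → Z'''.blueK {a'''} (st'''₅ σ)) ∧
            (Z₁.Rd a₁ u'''' (col₁₅ σ) → Z''''.blueK {a''''} (st''''₅ σ)) := by
  rw [blueK_iff_of_anchor, blueK₄_iff, mem_K_glue4_iff]
  unfold st'₅ st₅ st''₅ st'''₅ st''''₅ col₁₅
  rw [and_assoc, and_assoc, and_assoc]

end TwoExit

end ZoneZ

end PercRepro
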